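import Literature.Claims.NS.Chae2007
import Mathlib.Analysis.SpecialFunctions.Pow.Deriv

/-!
# C17 `Chae2007` — kernel refutation of Step 5 = (1.11) p. 5 (the ODE step, printed constant)

Cell `ns-claims` (D-0090 NS-CLAIMS SWEEP), claim C17; refuter `ns-claims-refuter-6`; referee `ns-claims-ref-2`
(RETYPE `ODE_honest`); typed skeleton `Literature.Claims.NS.Chae2007` (p464643, typist-11). Text of record:
D. Chae, «Global regularity of the 3D Navier–Stokes / Euler equations …», arXiv:0711.2453v1 (2007; withdrawn
by the author) [Chae2007GlobalRegularityWithdrawn].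

FIRST FAILING STEP (skeleton index order, TYPING-HYGIENE 11): `Step_5` = the sentence (1.11) p. 5 at the ODE
grain — «the differential inequality d/ds‖D³V‖ ≤ −(6γ/5 − C₀‖V₀‖^{1/6})‖D³V‖^{11/6}, which can be solved to
provide us with (1.11) ‖D³V(s)‖ ≤ ‖D³V₀‖ / [1 + (6γ/5 − C₀‖V₀‖^{1/6})‖D³V₀‖^{5/6} s]^{6/5}». Solving
`Z′ ≤ −cZ^{11/6}` by separation gives the constant `(5/6)c`, not `c`: the extremal solution
`Z(s) = (1 + (5/6)s)^{−6/5}` (`c = 1`, `Z(0) = 1`) meets the hypothesis with EQUALITY and exceeds the printed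
bound at every `s > 0` (checked at `s = 1/2`). Hence `not_Step_5_pos` (the positive-`Z` variant, verbatim the
shape pre-agreed on the cell bus as `ODE_printed`) and, by the skeleton's `step_5_pos_of_step_5`,
`not_Step_5`. Class: false lemma (countermodel). Steps 1–4 precede it: Step_2 (BKM a-priori bound, tree
fact by name) and Step_3 ((1.8), energy) are kernel-TRUE (`step2_holds`, `step3_energy_holds`,
SoloSalvageChae2007, salvage-p4); Step_1 (local existence in the class) and Step_4 (the differential
inequality (1.9)–(1.10), ∃C₀ ∀γ) are classical / true in substance and not attacked.

Load-bearing (MAP-SCHEMA §1b): (1.11) with the printed constant feeds (1.13)–(1.14) (`Step_6`) and the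
choice `γ = 5(C₀‖v₀‖^{1/6} + 1)` at (1.17) making `K = γ/(6γ/5 − C₀‖v₀‖^{1/6}) < 1` (`Step_8`, true as
arithmetic); with the honest constant the ratio is `K′ = γ/((5/6)(6γ/5 − C₀‖v₀‖^{1/6})) = γ/(γ − (5/6)C₀‖v₀‖^{1/6})
> 1` for every `γ`, so the bootstrap (1.15)–(1.19) (`Step_9`–`Step_11`) does not close — consistent with the
author's withdrawal. The honest ODE lemma `ODE_honest_holds` (p461963) is the charitable retype; it survives
and does not discharge the claim.

Closed terms; axioms `propext`, `Classical.choice`, `Quot.sound`.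

WHAT THIS IS NOT: not a claim about NS regularity or blow-up; not a claim about any author beyond the
typed locator.
-/

-- The summit's canonical theorem namespace repeats the summit name (single-conjunct summit).
set_option linter.dupNamespace false

noncomputable section

open Set

namespace Summit.NavierStokesRegularity.NavierStokesRegularity.Theorems.Chae2007

open Literature.Claims.NS.Chae2007

/-- The extremal solution of `Z' = -Z^{11/6}`, `Z 0 = 1` (c = 1): `Z s = (1 + (5/6) s)^{-6/5}`. -/
def Zex (s : ℝ) : ℝ := (1 + (5/6 : ℝ) * s) ^ (-(6:ℝ)/5)

/-- `0 < 1 + (5/6)s` for `s ≥ 0`. -/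
lemma base_pos {s : ℝ} (hs : 0 ≤ s) : 0 < 1 + (5/6 : ℝ) * s := by positivity

/-- `Z > 0` on `[0, ∞)`. -/
lemma Zex_pos {s : ℝ} (hs : 0 ≤ s) : 0 < Zex s :=
  Real.rpow_pos_of_pos (base_pos hs) _

/-- `Z(0) = 1`. -/
lemma Zex_zero : Zex 0 = 1 := by simp [Zex]

/-- `Z′(s) = −Z(s)^{11/6}` for `s ≥ 0`: the differential inequality holds with equality. -/
lemma hasDerivAt_Zex {s : ℝ} (hs : 0 ≤ s) :
    HasDerivAt Zex (-(Zex s) ^ ((11:ℝ)/6)) s := by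
  have hb : 0 < 1 + (5/6 : ℝ) * s := base_pos hs
  have h1 : HasDerivAt (fun x : ℝ => 1 + (5/6 : ℝ) * x) ((5/6 : ℝ)) s := by
    simpa using ((hasDerivAt_id s).const_mul (5/6 : ℝ)).const_add 1
  have h2 := h1.rpow_const (p := -(6:ℝ)/5) (Or.inl hb.ne')
  -- h2 : HasDerivAt (fun x => (1 + 5/6*x) ^ (-6/5)) (5/6 * (-6/5) * (1 + 5/6*s) ^ (-6/5 - 1)) s
  have hval : (5/6 : ℝ) * (-(6:ℝ)/5) * (1 + (5/6 : ℝ) * s) ^ (-(6:ℝ)/5 - 1)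
      = -(Zex s) ^ ((11:ℝ)/6) := by
    have : (Zex s) ^ ((11:ℝ)/6) = (1 + (5/6 : ℝ) * s) ^ (-(6:ℝ)/5 - 1) := by
      rw [Zex, ← Real.rpow_mul hb.le]
      norm_num
    rw [this]; ring
  rw [← hval]
  exact h2

/-- **`¬ Step_5_pos`** — the printed sentence (1.11) p. 5 («… which can be solved to provide us with
(1.11) ‖D³V(s)‖ ≤ ‖D³V₀‖ / [1 + c‖D³V₀‖^{5/6} s]^{6/5}») is false as a lemma about real functions:
for `c = 1`, `S = 1` the extremal solution `Z(s) = (1 + (5/6)s)^{−6/5}` of `Z′ = −Z^{11/6}`, `Z(0) = 1`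
satisfies the hypothesis with equality and violates the printed bound at `s = 1/2`:
`(17/12)^{−6/5} > (3/2)^{−6/5}`. Separating variables honestly gives `Z(s) ≤ Z₀/[1 + (5/6)cZ₀^{5/6}s]^{6/5}`
(the factor `5/6` is dropped in print; kernel: `ODE_honest_holds`, p461963). Class: false lemma
(countermodel). [cite: Chae2007GlobalRegularityWithdrawn, (1.11) p.5] -/
theorem not_Step_5_pos : ¬ Step_5_pos := by
  intro h
  have hhyp1 : ∀ s ∈ Ico (0:ℝ) 1, 0 < Zex s := fun s hs => Zex_pos hs.1
  have hhyp2 : ∀ s ∈ Ico (0:ℝ) 1,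
      DifferentiableAt ℝ Zex s ∧ deriv Zex s ≤ -1 * Zex s ^ ((11:ℝ)/6) := by
    intro s hs
    refine ⟨(hasDerivAt_Zex hs.1).differentiableAt, ?_⟩
    rw [(hasDerivAt_Zex hs.1).deriv]
    simp
  have hconc := h 1 1 one_pos one_pos Zex hhyp1 hhyp2 (1/2) ⟨by norm_num, by norm_num⟩
  rw [Zex_zero, Real.one_rpow] at hconc
  -- hconc : Zex (1/2) ≤ 1 / (1 + 1 * 1 * (1/2)) ^ (6/5)
  have hL : Zex (1/2) = ((17:ℝ)/12) ^ (-(6:ℝ)/5) := by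
    rw [Zex]; norm_num
  have hR : (1:ℝ) / (1 + 1 * 1 * (1/2 : ℝ)) ^ ((6:ℝ)/5) = ((3:ℝ)/2) ^ (-(6:ℝ)/5) := by
    rw [show (-(6:ℝ)/5) = -((6:ℝ)/5) by ring, Real.rpow_neg (by norm_num), inv_eq_one_div]
    norm_num
  rw [hL, hR] at hconc
  -- (17/12)^(-6/5) > (3/2)^(-6/5) since 17/12 < 3/2 and the exponent is negative
  have hlt : ((3:ℝ)/2) ^ (-(6:ℝ)/5) < ((17:ℝ)/12) ^ (-(6:ℝ)/5) :=
    Real.rpow_lt_rpow_of_neg (by norm_num) (by norm_num) (by norm_num)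
  exact absurd hconc (not_le.mpr hlt)

/-- **`¬ Step_5`** — (1.11) p. 5 as typed for nonnegative `Z` (the form the composition `claim_of_steps`
consumes): from `not_Step_5_pos` by the skeleton's weakening `step_5_pos_of_step_5`.
[cite: Chae2007GlobalRegularityWithdrawn, (1.11) p.5] -/
theorem not_Step_5 : ¬ Step_5 := fun h => not_Step_5_pos (step_5_pos_of_step_5 h)

end Summit.NavierStokesRegularity.NavierStokesRegularity.Theorems.Chae2007
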